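/-
Copyright: cell `pub-balaban-gaps` (G2), seat ne6 (row NE7b), `prover-pub-balaban-gaps-ne6-g15-0`. Released under the licence of the surrounding project.
-/
import Summits.QuantumFields.BalabanUV.T4Continuum.Spine.NE7b.CompactFibreWindowSUN
import Literature.MathematicalPhysics.QuantumFieldTheory.CircleHaarAngle
import Literature.MathematicalPhysics.QuantumFieldTheory.UnitaryHaarVolume
import Literature.MathematicalPhysics.QuantumLattice.OneLinkHarmonics

/-!
# THE EXPLICIT UPPER HALF OF THE SMALL-BALL LAW FOR `SU(N)`, ALL `N ≥ 1`: `Haar_{SU(N)}{‖V − 1‖_HS ≤ δ} ≤ π·c_N·vol b_{N²}(0,1)·5^{N²}·δ^{N²−1}` (`0 < δ ≤ 1∕10`),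
# `c_N` = Chatterjee's constant of the tree (`UnitaryCayley.haarChartConst`, valued in closed form by `UnitaryColumn.haarChartConst_eq`) — by a DETERMINANT-WINDOW
# SANDWICH: `Haar_{U(N)}{‖det U − 1‖ ≤ δ} · Haar_{SU(N)}(SB δ) ≤ Haar_{U(N)}(B(1, 2δ))` and `Haar_{U(N)}{‖det U − 1‖ ≤ δ} ≥ δ∕π` (row NE7b, node U5c; companion of
# `CompactFibreWindowSUNExplicit`, the explicit LOWER half from the tree's `B16ZLower`; together an explicit two-sided law at the exponent `N² − 1 = dim SU(N)`)

Cell `pub-balaban-gaps` (G2 spine census, V36) for the `pub-balaban` T⁴ crux NE7b (`T4WeightBudget.RelWeightBound`; the cell's OWN estimate — NOT PRINTED in [Bałaban 1983–89], NOT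
PROVED).  Crux-route work under `Spine/NE7b/`; NOTHING of Bałaban's is named or asserted; no `def`; zero `sorry`.  Imports: this seat's `CompactFibreWindowSUN` (V20: `haar_eq_lintegral_sections`
— averaged sections for compact `ι : H →* G` —, `continuous_inclusion_sun`, and through it the tree's `UnitaryCayleyChart`: `gball`, `chart`, `chartMeasure_le`, `gball_subset_image_chart`,
`haarChartConst`, `volume_closedBall_𝔼`), the tree's `CircleHaarAngle` (`CircleHaar.map_exp_angleMeasure`: Haar of `U(1)` in the angle parametrisation) and `UnitaryHaarVolume` (for the
closed form of `c_N`, cited) and `QuantumLattice.OneLinkHarmonics` (`norm_det_coe_unitaryGroup`).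

WHY.  V29 `CompactFibreWindowSUNRate` gives the two-sided law for `SU(N)` with SOFT constants (the tree's [VaropoulosSaloffcosteCoulhon1993] Thm. V.4.1 road) and V33 `CompactFibreWindowSUNExplicit`
the LOWER half (the price) with an explicit constant from the tree's covering bound `B16ZLower.haarReal_suOpBall_ge`.  The tree's UPPER half for `SU(N)` is soft (`HaarSmallBallTwoSided`:
a strict-differentiability radius of `exp`).  THIS FILE proves an EXPLICIT upper half from the tree's `U(N)` Cayley-chart bound (Chatterjee 2016, §11; the tree values the constant) by
fibring `U(N)` over its determinant: no chart of `SU(N)`, no Jacobian, no Weyl formula.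

WHAT IS PROVED ([folklore]):
* §1 `haar_gball_le_chartConst_mul_volume`, **`haar_gball_le_explicit`** (`Haar_{U(N)}(B(1,δ)) ≤ c_N·(5δ∕2)^{N²}·vol b(0,1)`, `0 ≤ δ ≤ 1∕5`; `κ(r) ≤ 5∕2` on `r ≤ ½`).
* §2 `exp_mem_arc_of_abs_le` (`‖e^{iθ} − 1‖ ≤ |θ|`), **`le_haar_circle_arc`** ∕ `le_haar_circle_arc_at` (`r∕π ≤ Haar_{U(1)}{‖z − w‖ ≤ r}`, `r ≤ π`: the angle measure of `(−r, r]`).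
* §3 (`N ≥ 1`) the diagonal circle `d(z) = diag(z, 1, …, 1)`: `exists_diagHom` (a continuous `U(1) →* U(N)`), `det_diagonal_update` (`det d(z) = z`), `norm_diagonal_update_sub_one` (`‖d(z) − 1‖_HS = ‖z − 1‖`),
  `diagonal_mem_unitaryGroup`, `update_one_mul`, `norm_update_one_eq`.
* §4 (`|det U| = 1` on `U(N)` is the tree's `QuantumLattice.norm_det_coe_unitaryGroup`, BY NAME), `measurableSet_detWindow`, **`le_haar_detWindow`** (`δ∕π ≤ Haar_{U(N)}{‖det U − 1‖ ≤ δ}`: every section along the diagonal circle is an arc of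
  half-width `δ` around `(det U)⁻¹`).
* §5 **`haar_sball_le_haar_section`** (for `‖det g − 1‖ ≤ δ′`, `h₀ := diag(det g, 1, …, 1)·g⁻¹ ∈ SU(N)` and the `(δ′ + δ)`-section through `g` contains the left translate `h₀·SB(δ)`),
  **`haar_detWindow_mul_sball_le_gball`** (the sandwich), **`haar_sball_le_explicit`** ∕ **`haarReal_sball_le_explicit`** (the title), **`le_neg_log_haar_sball_explicit`**
  (`(N² − 1)·log δ⁻¹ − (log π + log c_N + N²·log 5 + log vol b(0,1)) ≤ −log Haar_{SU(N)}(SB δ)`).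

HONEST REMARKS.  (a) The constant is Chatterjee's `c_N` times crude geometry (`5^{N²}`, `π`, `vol b(0,1)`), far from optimal; only the EXPONENT is sharp; V29's RATE limits already pin the
exponent, this file pins a VALUE.  (b) `N ≥ 1` (`[NeZero N]`): the diagonal circle needs a coordinate.  (c) Which window print uses at a creation step and that Bałaban's creation-level
carrier IS the compact-fibre one are (A3) ∕ (A1c) readings — NOT asserted.  Nothing of Bałaban's is asserted, valued or discharged.  NE7b NOT PRINTED ∕ NOT PROVED; spine PROVED 0∕9; rung
(B)+1 on a FINITE torus — NOT infinite volume, NOT the mass gap, NOT Clay.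
HONEST DEPENDENCY: continuum YM on T⁴ ⇐ BetaPertH ∧ nine spine estimates (0/9 proved); BetaPertH ⇐ (D1) ∧ (D4) ∧ CAP+tail;
G-an2-4 gates asym, D1 and NE2/3/4.  This file changes none of it.
-/

set_option autoImplicit false

open MeasureTheory Real Finset Metric
open scoped ENNReal Matrix.Norms.Frobenius
open Literature.MathematicalPhysics.QuantumFieldTheory (haarProbability)
open Literature.MathematicalPhysics.QuantumFieldTheory.UnitaryCayley (gball mem_gball measurableSet_gball chart chartMeasure chartMeasure_apply chartMeasure_le
  gball_subset_image_chart κ haarChartConst volume_closedBall_𝔼 𝔼)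
open Literature.MathematicalPhysics.QuantumFieldTheory.CircleHaar (angleMeasure map_exp_angleMeasure)
open Summit.QuantumFields.BalabanUV.T4Continuum.NE7b.CompactFibreWindowSUN (haar_eq_lintegral_sections measurableSet_sball)

namespace Summit.QuantumFields.BalabanUV.T4Continuum.NE7b.CompactFibreWindowSUNExplicitUpper

noncomputable section

variable {N : ℕ}

/-! ## §1 The tree's `U(N)` chart bound read as an EXPLICIT upper bound for small Hilbert–Schmidt balls of `U(N)` -/

/-- For `0 ≤ r ≤ ½`: `Haar_{U(N)}(B(1, r∕κ(r))) ≤ c_N · vol b(0, r)` — the tree's `gball_subset_image_chart` and `chartMeasure_le` (Chatterjee's constant `c_N = haarChartConst N`,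
valued in closed form by the tree's `UnitaryColumn.haarChartConst_eq`). [folklore] -/
theorem haar_gball_le_chartConst_mul_volume {r : ℝ} (hr0 : 0 ≤ r) (hr : r ≤ 1 / 2) :
    haarProbability (Matrix.unitaryGroup (Fin N) ℂ) (gball N (r / κ r)) ≤ haarChartConst N * volume (closedBall (0 : 𝔼 N) r) :=
  calc haarProbability (Matrix.unitaryGroup (Fin N) ℂ) (gball N (r / κ r)) ≤ haarProbability (Matrix.unitaryGroup (Fin N) ℂ) (chart '' closedBall (0 : 𝔼 N) r) :=
        measure_mono (gball_subset_image_chart hr0 hr)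
    _ = chartMeasure N (closedBall (0 : 𝔼 N) r) := (chartMeasure_apply _).symm
    _ ≤ haarChartConst N * volume (closedBall (0 : 𝔼 N) r) := chartMeasure_le _

/-- **EXPLICIT UPPER BOUND FOR `U(N)` BALLS**: for `0 ≤ δ ≤ 1∕5`, `Haar_{U(N)}{‖U − 1‖_HS ≤ δ} ≤ c_N · (5δ∕2)^{N²} · vol b(0, 1)` (take `r = 5δ∕2 ≤ ½`; `κ(r) = (1 + 2r)(1 + r∕2) ≤ 5∕2`, so `δ ≤ r∕κ(r)`).
[folklore] -/
theorem haar_gball_le_explicit {δ : ℝ} (hδ0 : 0 ≤ δ) (hδ : δ ≤ 1 / 5) :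
    haarProbability (Matrix.unitaryGroup (Fin N) ℂ) (gball N δ) ≤ haarChartConst N * (ENNReal.ofReal ((5 * δ / 2) ^ (N * N)) * volume (closedBall (0 : 𝔼 N) 1)) := by
  set r : ℝ := 5 * δ / 2 with hrdef
  have hr0 : 0 ≤ r := by positivity
  have hr : r ≤ 1 / 2 := by rw [hrdef]; linarith
  have hκ : κ r ≤ 5 / 2 := by
    unfold κ; nlinarith
  have hκpos : 0 < κ r := Literature.MathematicalPhysics.QuantumFieldTheory.UnitaryCayley.κ_pos hr0
  have hsub : gball N δ ⊆ gball N (r / κ r) := by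
    refine Literature.MathematicalPhysics.QuantumFieldTheory.UnitaryCayley.gball_mono ?_
    rw [le_div_iff₀ hκpos, hrdef]; nlinarith
  calc haarProbability (Matrix.unitaryGroup (Fin N) ℂ) (gball N δ) ≤ haarProbability (Matrix.unitaryGroup (Fin N) ℂ) (gball N (r / κ r)) := measure_mono hsub
    _ ≤ haarChartConst N * volume (closedBall (0 : 𝔼 N) r) := haar_gball_le_chartConst_mul_volume hr0 hr
    _ = haarChartConst N * (ENNReal.ofReal ((5 * δ / 2) ^ (N * N)) * volume (closedBall (0 : 𝔼 N) 1)) := by rw [volume_closedBall_𝔼 0 hr0]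

/-! ## §2 The normalised Haar measure of an arc of the circle: `Haar_{U(1)}{‖z − w‖ ≤ r} ≥ r∕π` (`0 ≤ r ≤ π`) -/

/-- `‖e^{iθ} − 1‖ ≤ |θ|`: the arc `{‖z − 1‖ ≤ r}` contains `exp(i·[−r, r])`. [folklore] -/
theorem exp_mem_arc_of_abs_le {θ r : ℝ} (h : |θ| ≤ r) : ‖((Circle.exp θ : Circle) : ℂ) - 1‖ ≤ r := by
  rw [Circle.coe_exp]
  have h1 : ‖Complex.exp (θ * Complex.I) - 1‖ ≤ ‖θ‖ := by
    have := Real.norm_exp_I_mul_ofReal_sub_one_le (x := θ)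
    rwa [mul_comm] at this
  exact h1.trans (by rwa [Real.norm_eq_abs])

/-- **ARCS ARE NOT SMALL**: `r∕π ≤ Haar_{U(1)}{‖z − 1‖ ≤ r}` for `0 ≤ r ≤ π` (the angle measure `(2π)⁻¹dθ` of `(−r, r]`, through the tree's `CircleHaar.map_exp_angleMeasure`). [folklore] -/
theorem le_haar_circle_arc {r : ℝ} (hr : r ≤ π) :
    ENNReal.ofReal (r / π) ≤ haarProbability Circle {z : Circle | ‖(z : ℂ) - 1‖ ≤ r} := by
  have hc : Continuous fun z : Circle => ‖(z : ℂ) - 1‖ := (continuous_subtype_val.sub continuous_const).norm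
  have hA : MeasurableSet[Circle.instMeasurableSpace] {z : Circle | ‖(z : ℂ) - 1‖ ≤ r} := (isClosed_le hc continuous_const).measurableSet
  rw [← map_exp_angleMeasure, Measure.map_apply Circle.exp.continuous.measurable hA]
  have hsub : Set.Ioc (-r) r ⊆ Circle.exp ⁻¹' {z : Circle | ‖(z : ℂ) - 1‖ ≤ r} := by
    intro θ hθ
    exact exp_mem_arc_of_abs_le (abs_le.2 ⟨hθ.1.le, hθ.2⟩)
  have hIoc : Set.Ioc (-r) r ⊆ Set.Ioc (-π) π := Set.Ioc_subset_Ioc (by linarith) hr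
  calc ENNReal.ofReal (r / π) = (ENNReal.ofReal (2 * π))⁻¹ * ENNReal.ofReal (2 * r) := by
        rw [← ENNReal.ofReal_inv_of_pos (by positivity), ← ENNReal.ofReal_mul (by positivity)]
        congr 1; field_simp
    _ = angleMeasure (Set.Ioc (-r) r) := by
        rw [angleMeasure, Measure.smul_apply, Measure.restrict_apply measurableSet_Ioc, Set.inter_eq_self_of_subset_left hIoc, Real.volume_Ioc, smul_eq_mul]
        ring_nf
    _ ≤ angleMeasure (Circle.exp ⁻¹' {z : Circle | ‖(z : ℂ) - 1‖ ≤ r}) := measure_mono hsub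

/-- The same for an arc around ANY point `w` of the circle (left invariance: `{‖z − w‖ ≤ r} = w·{‖z − 1‖ ≤ r}`). [folklore] -/
theorem le_haar_circle_arc_at {r : ℝ} (hr : r ≤ π) (w : Circle) :
    ENNReal.ofReal (r / π) ≤ haarProbability Circle {z : Circle | ‖(z : ℂ) - w‖ ≤ r} := by
  have hset : {z : Circle | ‖(z : ℂ) - w‖ ≤ r} = (fun z : Circle => w⁻¹ * z) ⁻¹' {z : Circle | ‖(z : ℂ) - 1‖ ≤ r} := by
    ext z
    simp only [Set.mem_setOf_eq, Set.mem_preimage, Circle.coe_mul, Circle.coe_inv]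
    have hw : ‖(w : ℂ)‖ = 1 := Circle.norm_coe w
    have hw0 : (w : ℂ) ≠ 0 := Circle.coe_ne_zero w
    have e : (w : ℂ)⁻¹ * z - 1 = (w : ℂ)⁻¹ * ((z : ℂ) - w) := by field_simp
    rw [e, norm_mul, norm_inv, hw, inv_one, one_mul]
  rw [hset, measure_preimage_mul]
  exact le_haar_circle_arc hr

/-! ## §3 The diagonal circle `z ↦ diag(z, 1, …, 1)` in `U(N)` (`N ≥ 1`): a continuous homomorphism with `det(d(z)·g) = z·det g` and `‖d(z) − 1‖_HS = ‖z − 1‖` -/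

section Diag

variable [NeZero N]

/-- Pointwise products of the updated diagonal vectors. [folklore] -/
theorem update_one_mul (z w : ℂ) : Function.update (1 : Fin N → ℂ) 0 z * Function.update (1 : Fin N → ℂ) 0 w = Function.update (1 : Fin N → ℂ) 0 (z * w) := by
  funext i
  by_cases hi : i = 0
  · subst hi; simp
  · simp [Function.update_of_ne hi]

omit [NeZero N] in
/-- A diagonal matrix with unit-modulus entries is unitary. [folklore] -/
theorem diagonal_mem_unitaryGroup {v : Fin N → ℂ} (hv : ∀ i, ‖v i‖ = 1) : Matrix.diagonal v ∈ Matrix.unitaryGroup (Fin N) ℂ := by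
  rw [Matrix.mem_unitaryGroup_iff, Matrix.star_eq_conjTranspose, Matrix.diagonal_conjTranspose, Matrix.diagonal_mul_diagonal, ← Matrix.diagonal_one]
  congr 1
  funext i
  have h : v i * (starRingEnd ℂ) (v i) = 1 := by
    rw [Complex.mul_conj, Complex.normSq_eq_norm_sq, hv i]; norm_num
  simpa [Pi.star_apply] using h

/-- The entries of `update 1 0 z` have unit modulus when `|z| = 1`. [folklore] -/
theorem norm_update_one_eq (z : Circle) (i : Fin N) : ‖Function.update (1 : Fin N → ℂ) 0 (z : ℂ) i‖ = 1 := by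
  by_cases hi : i = 0
  · subst hi; simp
  · simp [Function.update_of_ne hi]

/-- **THE DIAGONAL CIRCLE**: there is a continuous homomorphism `d : U(1) → U(N)`, `d(z) = diag(z, 1, …, 1)`. [folklore] -/
theorem exists_diagHom : ∃ d : Circle →* Matrix.unitaryGroup (Fin N) ℂ, Continuous d ∧ ∀ z : Circle, ((d z : Matrix.unitaryGroup (Fin N) ℂ) : Matrix (Fin N) (Fin N) ℂ) = Matrix.diagonal (Function.update (1 : Fin N → ℂ) 0 (z : ℂ)) := by
  let f : Circle → Matrix.unitaryGroup (Fin N) ℂ := fun z => ⟨Matrix.diagonal (Function.update (1 : Fin N → ℂ) 0 (z : ℂ)), diagonal_mem_unitaryGroup (norm_update_one_eq z)⟩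
  refine ⟨{ toFun := f, map_one' := ?_, map_mul' := ?_ }, ?_, fun z => rfl⟩
  · apply Subtype.ext
    show Matrix.diagonal (Function.update (1 : Fin N → ℂ) 0 ((1 : Circle) : ℂ)) = 1
    have hu : Function.update (1 : Fin N → ℂ) 0 ((1 : Circle) : ℂ) = 1 := by
      funext i; by_cases hi : i = 0
      · subst hi; simp
      · simp [Function.update_of_ne hi]
    rw [hu]; exact Matrix.diagonal_one
  · intro z w
    apply Subtype.ext
    show Matrix.diagonal (Function.update (1 : Fin N → ℂ) 0 ((z * w : Circle) : ℂ)) = Matrix.diagonal (Function.update (1 : Fin N → ℂ) 0 (z : ℂ)) * Matrix.diagonal (Function.update (1 : Fin N → ℂ) 0 (w : ℂ))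
    rw [Matrix.diagonal_mul_diagonal, Circle.coe_mul, ← update_one_mul]; rfl
  · show Continuous f
    exact Continuous.subtype_mk ((continuous_const.update 0 continuous_subtype_val).matrix_diagonal) _

/-- `det(diag(z, 1, …, 1)) = z`. [folklore] -/
theorem det_diagonal_update (z : ℂ) : (Matrix.diagonal (Function.update (1 : Fin N → ℂ) 0 z)).det = z := by
  rw [Matrix.det_diagonal, Finset.prod_update_of_mem (Finset.mem_univ _)]
  simp

/-- `‖diag(z, 1, …, 1) − 1‖_HS = ‖z − 1‖`. [folklore] -/
theorem norm_diagonal_update_sub_one (z : ℂ) : ‖Matrix.diagonal (Function.update (1 : Fin N → ℂ) 0 z) - 1‖ = ‖z - 1‖ := by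
  have e : Matrix.diagonal (Function.update (1 : Fin N → ℂ) 0 z) - 1 = Matrix.diagonal (Pi.single (0 : Fin N) (z - 1)) := by
    rw [← Matrix.diagonal_one, Matrix.diagonal_sub]
    congr 1
    funext i
    by_cases hi : i = 0
    · subst hi; simp
    · simp [Function.update_of_ne hi, Pi.single_eq_of_ne hi]
  rw [e]
  have hsq : ‖Matrix.diagonal (Pi.single (0 : Fin N) (z - 1))‖ ^ 2 = ‖z - 1‖ ^ 2 := by
    rw [Literature.MathematicalPhysics.QuantumFieldTheory.UnitaryCayley.frobenius_norm_sq]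
    rw [Finset.sum_eq_single (0 : Fin N) (fun j _ hj => by
          refine Finset.sum_eq_zero fun k _ => ?_
          rw [Matrix.diagonal_apply]; split_ifs with h
          · subst h; rw [Pi.single_eq_of_ne hj]; simp
          · simp) (fun h => absurd (Finset.mem_univ _) h)]
    rw [Finset.sum_eq_single (0 : Fin N) (fun k _ hk => by rw [Matrix.diagonal_apply_ne _ (Ne.symm hk)]; simp) (fun h => absurd (Finset.mem_univ _) h)]
    simp
  nlinarith [norm_nonneg (Matrix.diagonal (Pi.single (0 : Fin N) (z - 1))), norm_nonneg (z - 1), sq_nonneg (‖Matrix.diagonal (Pi.single (0 : Fin N) (z - 1))‖ - ‖z - 1‖),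
    sq_nonneg (‖Matrix.diagonal (Pi.single (0 : Fin N) (z - 1))‖ + ‖z - 1‖)]

end Diag

/-! ## §4 The determinant is unimodular on `U(N)`; the determinant window `{‖det U − 1‖ ≤ r}` has Haar measure `≥ r∕π` -/

/-- The determinant window is measurable (closed). [folklore] -/
theorem measurableSet_detWindow (r : ℝ) : MeasurableSet {U : Matrix.unitaryGroup (Fin N) ℂ | ‖(U : Matrix (Fin N) (Fin N) ℂ).det - 1‖ ≤ r} :=
  (isClosed_le ((continuous_subtype_val.matrix_det.sub continuous_const).norm) continuous_const).measurableSet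

/-- **THE DETERMINANT WINDOW IS NOT SMALL** (`N ≥ 1`, `0 ≤ r ≤ π`): `r∕π ≤ Haar_{U(N)}{‖det U − 1‖ ≤ r}` — every section along the diagonal circle is an arc of half-width `≥ r` around the
unit complex number `(det U)⁻¹` (`det(d(z)U) = z·det U`), and arcs have measure `≥ r∕π` (§2); averaged sections (`CompactFibreWindowSUN.haar_eq_lintegral_sections`). [folklore] -/
theorem le_haar_detWindow [NeZero N] {r : ℝ} (hr : r ≤ π) :
    ENNReal.ofReal (r / π) ≤ haarProbability (Matrix.unitaryGroup (Fin N) ℂ) {U : Matrix.unitaryGroup (Fin N) ℂ | ‖(U : Matrix (Fin N) (Fin N) ℂ).det - 1‖ ≤ r} := by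
  obtain ⟨d, hd, hdz⟩ := exists_diagHom (N := N)
  rw [haar_eq_lintegral_sections d hd (measurableSet_detWindow r)]
  calc ENNReal.ofReal (r / π) = ∫⁻ _U, ENNReal.ofReal (r / π) ∂(haarProbability (Matrix.unitaryGroup (Fin N) ℂ)) := by rw [lintegral_const, measure_univ, mul_one]
    _ ≤ _ := lintegral_mono fun U => ?_
  -- the section through `U` contains the arc of half-width `r` around `(det U)⁻¹`
  have hw1 : ‖(U : Matrix (Fin N) (Fin N) ℂ).det‖ = 1 := Literature.MathematicalPhysics.QuantumLattice.norm_det_coe_unitaryGroup U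
  have hw0 : (U : Matrix (Fin N) (Fin N) ℂ).det ≠ 0 := fun h => by rw [h, norm_zero] at hw1; exact zero_ne_one hw1
  let w : Circle := ⟨((U : Matrix (Fin N) (Fin N) ℂ).det)⁻¹, show ((U : Matrix (Fin N) (Fin N) ℂ).det)⁻¹ ∈ Metric.sphere (0 : ℂ) 1 by
    rw [mem_sphere_zero_iff_norm, norm_inv, hw1, inv_one]⟩
  have hwc : (w : ℂ) = ((U : Matrix (Fin N) (Fin N) ℂ).det)⁻¹ := rfl
  have hsub : {z : Circle | ‖(z : ℂ) - w‖ ≤ r} ⊆ {z : Circle | d z * U ∈ {U : Matrix.unitaryGroup (Fin N) ℂ | ‖(U : Matrix (Fin N) (Fin N) ℂ).det - 1‖ ≤ r}} := by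
    intro z hz
    simp only [Set.mem_setOf_eq] at hz ⊢
    rw [Submonoid.coe_mul, Matrix.det_mul, hdz, det_diagonal_update]
    have e : (z : ℂ) * (U : Matrix (Fin N) (Fin N) ℂ).det - 1 = (U : Matrix (Fin N) (Fin N) ℂ).det * ((z : ℂ) - w) := by
      rw [hwc, mul_sub, mul_inv_cancel₀ hw0, mul_comm]
    rw [e, norm_mul, hw1, one_mul]; exact hz
  exact (le_haar_circle_arc_at hr w).trans (measure_mono hsub)

/-! ## §5 Sections over `SU(N)` are LARGE on the determinant window; hence the explicit upper bound for `SU(N)` balls -/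

/-- **SECTIONS OVER THE DETERMINANT WINDOW ARE LARGE** (`N ≥ 1`): if `‖det g − 1‖ ≤ δ′` then `h₀ := d((det g)⁻¹)⁻¹·g⁻¹`… concretely `h₀ := diag(det g, 1, …, 1)·g⁻¹ ∈ SU(N)` has `h₀·g = diag(det g, 1, …, 1)`,
and for every `h₁ ∈ SU(N)` with `‖h₁ − 1‖_HS ≤ δ` one gets `‖(h₀h₁)·g − 1‖_HS ≤ δ′ + δ`; so the `(δ′ + δ)`-section through `g` contains the left translate `h₀·SB(δ)` and has Haar measure
`≥ Haar_{SU(N)}(SB δ)`. [folklore] -/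
theorem haar_sball_le_haar_section [NeZero N] {δ δ' : ℝ} (g : Matrix.unitaryGroup (Fin N) ℂ) (hg : ‖(g : Matrix (Fin N) (Fin N) ℂ).det - 1‖ ≤ δ') :
    haarProbability (Matrix.specialUnitaryGroup (Fin N) ℂ) {V : Matrix.specialUnitaryGroup (Fin N) ℂ | ‖(V : Matrix (Fin N) (Fin N) ℂ) - 1‖ ≤ δ} ≤
      haarProbability (Matrix.specialUnitaryGroup (Fin N) ℂ) {h : Matrix.specialUnitaryGroup (Fin N) ℂ | ‖(h : Matrix (Fin N) (Fin N) ℂ) * (g : Matrix (Fin N) (Fin N) ℂ) - 1‖ ≤ δ' + δ} := by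
  -- the matrix `D = diag(det g, 1, …, 1)` and `h₀ = D·g⁻¹ ∈ SU(N)`
  set w : ℂ := (g : Matrix (Fin N) (Fin N) ℂ).det with hwdef
  have hw1 : ‖w‖ = 1 := Literature.MathematicalPhysics.QuantumLattice.norm_det_coe_unitaryGroup g
  set D : Matrix (Fin N) (Fin N) ℂ := Matrix.diagonal (Function.update (1 : Fin N → ℂ) 0 w) with hD
  have hDu : D ∈ Matrix.unitaryGroup (Fin N) ℂ := diagonal_mem_unitaryGroup fun i => by
    by_cases hi : i = 0
    · subst hi; simpa using hw1
    · simp [Function.update_of_ne hi]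
  have hginv : ((g⁻¹ : Matrix.unitaryGroup (Fin N) ℂ) : Matrix (Fin N) (Fin N) ℂ) * (g : Matrix (Fin N) (Fin N) ℂ) = 1 := by
    rw [← Submonoid.coe_mul, inv_mul_cancel]; rfl
  have hdet_inv : ((g⁻¹ : Matrix.unitaryGroup (Fin N) ℂ) : Matrix (Fin N) (Fin N) ℂ).det * w = 1 := by
    rw [hwdef, ← Matrix.det_mul, hginv, Matrix.det_one]
  set H₀ : Matrix (Fin N) (Fin N) ℂ := D * ((g⁻¹ : Matrix.unitaryGroup (Fin N) ℂ) : Matrix (Fin N) (Fin N) ℂ) with hH₀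
  have hH₀u : H₀ ∈ Matrix.unitaryGroup (Fin N) ℂ := Submonoid.mul_mem _ hDu (g⁻¹).2
  have hH₀det : H₀.det = 1 := by
    rw [hH₀, Matrix.det_mul, hD, det_diagonal_update, mul_comm]; exact hdet_inv
  have hH₀su : H₀ ∈ Matrix.specialUnitaryGroup (Fin N) ℂ := Matrix.mem_specialUnitaryGroup_iff.2 ⟨hH₀u, hH₀det⟩
  set h₀ : Matrix.specialUnitaryGroup (Fin N) ℂ := ⟨H₀, hH₀su⟩ with hh₀
  have hH₀g : H₀ * (g : Matrix (Fin N) (Fin N) ℂ) = D := by rw [hH₀, Matrix.mul_assoc, hginv, Matrix.mul_one]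
  -- the left translate `h₀ · SB(δ)` lies in the section
  have hsub : (fun h : Matrix.specialUnitaryGroup (Fin N) ℂ => h₀⁻¹ * h) ⁻¹' {V : Matrix.specialUnitaryGroup (Fin N) ℂ | ‖(V : Matrix (Fin N) (Fin N) ℂ) - 1‖ ≤ δ} ⊆
      {h : Matrix.specialUnitaryGroup (Fin N) ℂ | ‖(h : Matrix (Fin N) (Fin N) ℂ) * (g : Matrix (Fin N) (Fin N) ℂ) - 1‖ ≤ δ' + δ} := by
    intro h hh
    simp only [Set.mem_preimage, Set.mem_setOf_eq] at hh ⊢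
    -- `X := h₀⁻¹ h`, `K := h₀⁻¹` (as matrices): `h = H₀ X`, `g = K D`, `h g − 1 = H₀ (X − 1) (K D) + (D − 1)`
    have hKu : ((h₀⁻¹ : Matrix.specialUnitaryGroup (Fin N) ℂ) : Matrix (Fin N) (Fin N) ℂ) ∈ Matrix.unitaryGroup (Fin N) ℂ := (Matrix.mem_specialUnitaryGroup_iff.1 (h₀⁻¹).2).1
    have e0 : ((h₀⁻¹ : Matrix.specialUnitaryGroup (Fin N) ℂ) : Matrix (Fin N) (Fin N) ℂ) * H₀ = 1 := by
      rw [show H₀ = ((h₀ : Matrix.specialUnitaryGroup (Fin N) ℂ) : Matrix (Fin N) (Fin N) ℂ) from rfl, ← Submonoid.coe_mul, inv_mul_cancel]; rfl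
    have e0' : H₀ * ((h₀⁻¹ : Matrix.specialUnitaryGroup (Fin N) ℂ) : Matrix (Fin N) (Fin N) ℂ) = 1 := by
      rw [show H₀ = ((h₀ : Matrix.specialUnitaryGroup (Fin N) ℂ) : Matrix (Fin N) (Fin N) ℂ) from rfl, ← Submonoid.coe_mul, mul_inv_cancel]; rfl
    have hX : (h : Matrix (Fin N) (Fin N) ℂ) = H₀ * ((h₀⁻¹ * h : Matrix.specialUnitaryGroup (Fin N) ℂ) : Matrix (Fin N) (Fin N) ℂ) := by
      rw [Submonoid.coe_mul, ← Matrix.mul_assoc, e0', Matrix.one_mul]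
    have hgK : (g : Matrix (Fin N) (Fin N) ℂ) = ((h₀⁻¹ : Matrix.specialUnitaryGroup (Fin N) ℂ) : Matrix (Fin N) (Fin N) ℂ) * D := by
      rw [← hH₀g, ← Matrix.mul_assoc, e0, Matrix.one_mul]
    have hKDu : ((h₀⁻¹ : Matrix.specialUnitaryGroup (Fin N) ℂ) : Matrix (Fin N) (Fin N) ℂ) * D ∈ Matrix.unitaryGroup (Fin N) ℂ := Submonoid.mul_mem _ hKu hDu
    have e : (h : Matrix (Fin N) (Fin N) ℂ) * (g : Matrix (Fin N) (Fin N) ℂ) - 1 =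
        H₀ * ((((h₀⁻¹ * h : Matrix.specialUnitaryGroup (Fin N) ℂ) : Matrix (Fin N) (Fin N) ℂ) - 1) * (((h₀⁻¹ : Matrix.specialUnitaryGroup (Fin N) ℂ) : Matrix (Fin N) (Fin N) ℂ) * D)) + (D - 1) := by
      have hD1 : D - 1 = H₀ * ((h₀⁻¹ : Matrix.specialUnitaryGroup (Fin N) ℂ) : Matrix (Fin N) (Fin N) ℂ) * D - 1 := by rw [e0', Matrix.one_mul]
      rw [hD1, hX, hgK]
      noncomm_ring
    rw [e]
    calc ‖H₀ * ((((h₀⁻¹ * h : Matrix.specialUnitaryGroup (Fin N) ℂ) : Matrix (Fin N) (Fin N) ℂ) - 1) * (((h₀⁻¹ : Matrix.specialUnitaryGroup (Fin N) ℂ) : Matrix (Fin N) (Fin N) ℂ) * D)) + (D - 1)‖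
        ≤ ‖H₀ * ((((h₀⁻¹ * h : Matrix.specialUnitaryGroup (Fin N) ℂ) : Matrix (Fin N) (Fin N) ℂ) - 1) * (((h₀⁻¹ : Matrix.specialUnitaryGroup (Fin N) ℂ) : Matrix (Fin N) (Fin N) ℂ) * D))‖ + ‖D - 1‖ := norm_add_le _ _
      _ = ‖((h₀⁻¹ * h : Matrix.specialUnitaryGroup (Fin N) ℂ) : Matrix (Fin N) (Fin N) ℂ) - 1‖ + ‖w - 1‖ := by
          rw [Matrix.frobenius_norm_unitaryGroup_mul ⟨H₀, hH₀u⟩, Matrix.frobenius_norm_mul_unitaryGroup _ ⟨_, hKDu⟩, hD, norm_diagonal_update_sub_one]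
      _ ≤ δ + δ' := add_le_add hh (by rw [hwdef]; exact hg)
      _ = δ' + δ := add_comm _ _
  calc haarProbability (Matrix.specialUnitaryGroup (Fin N) ℂ) {V : Matrix.specialUnitaryGroup (Fin N) ℂ | ‖(V : Matrix (Fin N) (Fin N) ℂ) - 1‖ ≤ δ}
      = haarProbability (Matrix.specialUnitaryGroup (Fin N) ℂ) ((fun h : Matrix.specialUnitaryGroup (Fin N) ℂ => h₀⁻¹ * h) ⁻¹' {V : Matrix.specialUnitaryGroup (Fin N) ℂ | ‖(V : Matrix (Fin N) (Fin N) ℂ) - 1‖ ≤ δ}) :=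
        (measure_preimage_mul _ _ _).symm
    _ ≤ _ := measure_mono hsub

/-- **THE SANDWICH** (`N ≥ 1`, `δ, δ′ ≥ 0`): `Haar_{U(N)}{‖det U − 1‖ ≤ δ′} · Haar_{SU(N)}(SB δ) ≤ Haar_{U(N)}(B(1, δ′ + δ))` (averaged sections over `SU(N) ↪ U(N)`, each section through the
determinant window being at least `Haar(SB δ)`). [folklore] -/
theorem haar_detWindow_mul_sball_le_gball [NeZero N] (δ δ' : ℝ) :
    haarProbability (Matrix.unitaryGroup (Fin N) ℂ) {U : Matrix.unitaryGroup (Fin N) ℂ | ‖(U : Matrix (Fin N) (Fin N) ℂ).det - 1‖ ≤ δ'} *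
        haarProbability (Matrix.specialUnitaryGroup (Fin N) ℂ) {V : Matrix.specialUnitaryGroup (Fin N) ℂ | ‖(V : Matrix (Fin N) (Fin N) ℂ) - 1‖ ≤ δ} ≤
      haarProbability (Matrix.unitaryGroup (Fin N) ℂ) (gball N (δ' + δ)) := by
  rw [haar_eq_lintegral_sections (Submonoid.inclusion (Matrix.specialUnitaryGroup_le_unitaryGroup (n := Fin N) (α := ℂ))) CompactFibreWindowSUN.continuous_inclusion_sun (measurableSet_gball _)]
  rw [mul_comm, ← lintegral_indicator_const (measurableSet_detWindow δ')]
  refine lintegral_mono fun U => ?_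
  by_cases hU : U ∈ {U : Matrix.unitaryGroup (Fin N) ℂ | ‖(U : Matrix (Fin N) (Fin N) ℂ).det - 1‖ ≤ δ'}
  · rw [Set.indicator_of_mem hU]
    have hset : {h : Matrix.specialUnitaryGroup (Fin N) ℂ | (Submonoid.inclusion (Matrix.specialUnitaryGroup_le_unitaryGroup (n := Fin N) (α := ℂ))) h * U ∈ gball N (δ' + δ)} =
        {h : Matrix.specialUnitaryGroup (Fin N) ℂ | ‖(h : Matrix (Fin N) (Fin N) ℂ) * (U : Matrix (Fin N) (Fin N) ℂ) - 1‖ ≤ δ' + δ} := by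
      ext h; simp only [Set.mem_setOf_eq, mem_gball, Submonoid.coe_mul, CompactFibreWindowSUN.coe_inclusion_sun]
    rw [hset]
    exact haar_sball_le_haar_section U hU
  · rw [Set.indicator_of_notMem hU]; exact bot_le

/-- **EXPLICIT UPPER BOUND FOR SMALL HILBERT–SCHMIDT BALLS OF `SU(N)`** (`N ≥ 1`, `0 < δ ≤ 1∕10`):
`Haar_{SU(N)}{‖V − 1‖_HS ≤ δ} ≤ (π∕δ) · c_N · (5δ)^{N²} · vol b(0,1) = π·c_N·vol b(0,1)·5^{N²}·δ^{N²−1}` — exponent `N² − 1 = dim SU(N)`, every constant explicit: `c_N = haarChartConst N`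
(Chatterjee's small-ball constant, valued by the tree's `UnitaryColumn.haarChartConst_eq`), `vol b(0,1)` = the Lebesgue volume of the unit ball of `ℝ^{N²}` (Mathlib). [folklore] -/
theorem haar_sball_le_explicit [NeZero N] {δ : ℝ} (hδ0 : 0 < δ) (hδ : δ ≤ 1 / 10) :
    haarProbability (Matrix.specialUnitaryGroup (Fin N) ℂ) {V : Matrix.specialUnitaryGroup (Fin N) ℂ | ‖(V : Matrix (Fin N) (Fin N) ℂ) - 1‖ ≤ δ} ≤
      ENNReal.ofReal (π / δ) * (haarChartConst N * (ENNReal.ofReal ((5 * δ) ^ (N * N)) * volume (closedBall (0 : 𝔼 N) 1))) := by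
  have hπ : 0 < π := Real.pi_pos
  have hδπ : δ ≤ π := by linarith [Real.pi_gt_three]
  have hE := le_haar_detWindow (N := N) hδπ
  have hS := haar_detWindow_mul_sball_le_gball (N := N) δ δ
  have hU := haar_gball_le_explicit (N := N) (δ := δ + δ) (by positivity) (by linarith)
  have h5 : (5 * (δ + δ) / 2) = 5 * δ := by ring
  rw [h5] at hU
  -- `ofReal(δ∕π) · m ≤ Haar(gball 2δ) ≤ c·(5δ)^{N²}·vol`, then divide by `ofReal(δ∕π)`
  have hkey : ENNReal.ofReal (δ / π) * haarProbability (Matrix.specialUnitaryGroup (Fin N) ℂ) {V : Matrix.specialUnitaryGroup (Fin N) ℂ | ‖(V : Matrix (Fin N) (Fin N) ℂ) - 1‖ ≤ δ} ≤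
      haarChartConst N * (ENNReal.ofReal ((5 * δ) ^ (N * N)) * volume (closedBall (0 : 𝔼 N) 1)) :=
    ((mul_le_mul' hE le_rfl).trans hS).trans hU
  have hne : ENNReal.ofReal (δ / π) ≠ 0 := by rw [ne_eq, ENNReal.ofReal_eq_zero, not_le]; positivity
  have hinv : ENNReal.ofReal (π / δ) = (ENNReal.ofReal (δ / π))⁻¹ := by
    rw [← ENNReal.ofReal_inv_of_pos (by positivity)]; congr 1; rw [inv_div]
  calc haarProbability (Matrix.specialUnitaryGroup (Fin N) ℂ) {V : Matrix.specialUnitaryGroup (Fin N) ℂ | ‖(V : Matrix (Fin N) (Fin N) ℂ) - 1‖ ≤ δ}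
      = (ENNReal.ofReal (δ / π))⁻¹ * (ENNReal.ofReal (δ / π) * haarProbability (Matrix.specialUnitaryGroup (Fin N) ℂ) {V : Matrix.specialUnitaryGroup (Fin N) ℂ | ‖(V : Matrix (Fin N) (Fin N) ℂ) - 1‖ ≤ δ}) := by
        rw [← mul_assoc, ENNReal.inv_mul_cancel hne ENNReal.ofReal_ne_top, one_mul]
    _ ≤ (ENNReal.ofReal (δ / π))⁻¹ * (haarChartConst N * (ENNReal.ofReal ((5 * δ) ^ (N * N)) * volume (closedBall (0 : 𝔼 N) 1))) := mul_le_mul' le_rfl hkey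
    _ = _ := by rw [hinv]

/-- The same in real form: `Haar_{SU(N)}(SB δ).toReal ≤ (π∕δ)·c_N·(5δ)^{N²}·vol b(0,1)` for `0 < δ ≤ 1∕10`, `N ≥ 1`. [folklore] -/
theorem haarReal_sball_le_explicit [NeZero N] {δ : ℝ} (hδ0 : 0 < δ) (hδ : δ ≤ 1 / 10) :
    ((haarProbability (Matrix.specialUnitaryGroup (Fin N) ℂ)) {V : Matrix.specialUnitaryGroup (Fin N) ℂ | ‖(V : Matrix (Fin N) (Fin N) ℂ) - 1‖ ≤ δ}).toReal ≤
      π / δ * ((haarChartConst N : ℝ) * ((5 * δ) ^ (N * N) * (volume (closedBall (0 : 𝔼 N) 1)).toReal)) := by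
  have h := haar_sball_le_explicit (N := N) hδ0 hδ
  have hvol : volume (closedBall (0 : 𝔼 N) 1) ≠ ∞ := (Literature.MathematicalPhysics.QuantumFieldTheory.UnitaryCayley.volume_closedBall_𝔼_lt_top 0 1).ne
  have htop : ENNReal.ofReal (π / δ) * (haarChartConst N * (ENNReal.ofReal ((5 * δ) ^ (N * N)) * volume (closedBall (0 : 𝔼 N) 1))) ≠ ∞ := by
    refine ENNReal.mul_ne_top ENNReal.ofReal_ne_top (ENNReal.mul_ne_top ENNReal.coe_ne_top (ENNReal.mul_ne_top ENNReal.ofReal_ne_top hvol))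
  have h' := ENNReal.toReal_mono htop h
  rw [ENNReal.toReal_mul, ENNReal.toReal_mul, ENNReal.toReal_mul, ENNReal.toReal_ofReal (by positivity), ENNReal.toReal_ofReal (by positivity), ENNReal.coe_toReal] at h'
  exact h'

/-- **THE LOWER LETTER, EXPLICIT** (`N ≥ 1`, `0 < δ ≤ 1∕10`): `(N² − 1)·log δ⁻¹ − (log π + log c_N + N²·log 5 + log vol b(0,1)) ≤ −log Haar_{SU(N)}{‖V − 1‖_HS ≤ δ}` (the window's mass is positive by
V20's `exists_haar_sball_ge`). [folklore] -/
theorem le_neg_log_haar_sball_explicit [NeZero N] {δ : ℝ} (hδ0 : 0 < δ) (hδ : δ ≤ 1 / 10) :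
    ((N : ℝ) * N - 1) * Real.log δ⁻¹ - (Real.log π + Real.log (haarChartConst N : ℝ) + (N : ℝ) * N * Real.log 5 + Real.log (volume (closedBall (0 : 𝔼 N) 1)).toReal) ≤
      -Real.log ((haarProbability (Matrix.specialUnitaryGroup (Fin N) ℂ)) {V : Matrix.specialUnitaryGroup (Fin N) ℂ | ‖(V : Matrix (Fin N) (Fin N) ℂ) - 1‖ ≤ δ}).toReal := by
  have hπ : 0 < π := Real.pi_pos
  have hc : 0 < (haarChartConst N : ℝ) := by exact_mod_cast Literature.MathematicalPhysics.QuantumFieldTheory.UnitaryCayley.haarChartConst_pos (N := N)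
  have hv : 0 < (volume (closedBall (0 : 𝔼 N) 1)).toReal :=
    ENNReal.toReal_pos (Literature.MathematicalPhysics.QuantumFieldTheory.UnitaryCayley.volume_closedBall_𝔼_pos 0 one_pos).ne'
      (Literature.MathematicalPhysics.QuantumFieldTheory.UnitaryCayley.volume_closedBall_𝔼_lt_top 0 1).ne
  -- positivity of the window's mass (V20)
  obtain ⟨C, hC, hlow⟩ := CompactFibreWindowSUN.exists_haar_sball_ge (N := N)
  have hm : 0 < ((haarProbability (Matrix.specialUnitaryGroup (Fin N) ℂ)) {V : Matrix.specialUnitaryGroup (Fin N) ℂ | ‖(V : Matrix (Fin N) (Fin N) ℂ) - 1‖ ≤ δ}).toReal := by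
    have h := (ENNReal.ofReal_le_iff_le_toReal (measure_ne_top _ _)).1 (hlow δ hδ0 (by linarith))
    exact lt_of_lt_of_le (by positivity) h
  have hup := haarReal_sball_le_explicit (N := N) hδ0 hδ
  have hB : 0 < π / δ * ((haarChartConst N : ℝ) * ((5 * δ) ^ (N * N) * (volume (closedBall (0 : 𝔼 N) 1)).toReal)) := by positivity
  have hlog := Real.log_le_log hm hup
  rw [Real.log_mul (by positivity) (by positivity), Real.log_div hπ.ne' hδ0.ne', Real.log_mul hc.ne' (by positivity), Real.log_mul (by positivity) hv.ne', Real.log_pow,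
    Real.log_mul (by norm_num) hδ0.ne'] at hlog
  rw [Real.log_inv]
  push_cast at hlog ⊢
  nlinarith [hlog]

end

end Summit.QuantumFields.BalabanUV.T4Continuum.NE7b.CompactFibreWindowSUNExplicitUpper
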